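import Literature.LinearAlgebra.Matrix.UnitaryGroupExpSurjective
import Literature.LinearAlgebra.Matrix.UnitaryGroupMaximalToriConjugate
import HarnessLib

/-!
# NE7CommutingUnitaryLogs — A COMMUTING FAMILY OF UNITARY MATRICES HAS COMMUTING SKEW-HERMITIAN LOGARITHMS (one unitary diagonalises them all)

Cell `pub-balaban`, rung (B)+1 sub-cell t4, lineage `b2b-balaban-t4-ne7-p2`, generation 89 (CRUX PROVER NE7 #2 = co-owner of row NE7, kernel hand); file (G1)
of the gen-89 line «the (APE) END along the FLAT STRATUM», over the tree's simultaneous unitary diagonalisation of commuting Hermitian families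
(`Literature.LinearAlgebra.Matrix.UnitaryGroupMaximalToriConjugate.exists_unitaryGroup_forall_conj_eq_diagonal_of_commute`, Horn–Johnson 2.5.5) and the
exponential of the diagonal torus (`Literature.LinearAlgebra.Matrix.UnitaryGroupExpSurjective`, Bröcker–tom Dieck IV (2.2)).
WHY.  (G2) `NE7FlatDatumNormalForm` turns the fibre over a flat datum into the fibre over a CONSTANT commuting datum, GIVEN pairwise commuting skew-Hermitian
logarithms `Y_i` of the axis holonomies `τ_i` (commuting unitaries).  This file supplies them: ONE unitary `V` diagonalises every `τ_i` (the tree's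
Horn–Johnson 2.5.5 for unitary families: `V⋆ τ_i V = diag(d_i)`, `|d_{ik}| = 1`), and `Y_i := V diag(i·arg d_{ik}) V⋆` are skew-Hermitian, pairwise
commuting, with `exp Y_i = τ_i`.
WHAT ([folklore]; 0 def, 0 sorry).  **`exists_commuting_skewAdjoint_log`** (`∃ Y`, `Y_i ∈ 𝔲(n)`, `[Y_i, Y_j] = 0`, `exp Y_i = τ_i`).
HONEST FRAMING (page 1): textbook linear algebra ([folklore]) assembled from tree theorems BY NAME; nothing of Bałaban's asserted; moves no letter by itself;
(APE) on the data class NOT proved; NE7 NOT PRINTED ∕ NOT PROVED; spine PROVED 0∕9; FIXED FINITE T⁴, rung (B)+1 — NOT infinite volume, NOT mass gap, NOT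
BetaPertH, NOT Clay.  Continuum YM on T⁴ ⇐ BetaPertH ∧ nine spine estimates (0/9 proved); BetaPertH ⇐ (D1) ∧ (D4) ∧ CAP+tail; G-an2-4 gates asym, D1 and NE2/3/4.
-/

set_option autoImplicit false

open Matrix

namespace Summit.QuantumFields.BalabanUV.T4Continuum.NE7CommutingUnitaryLogs

open Literature.LinearAlgebra.Matrix

noncomputable section

variable {n : Type*} [DecidableEq n] [Fintype n] {ι : Type*}

/-! ## Commuting skew-Hermitian logarithms -/

/-- **COMMUTING UNITARIES HAVE COMMUTING SKEW-HERMITIAN LOGARITHMS**: for a pairwise commuting family of unitary matrices `τ_i` there are skew-Hermitian,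
pairwise commuting `Y_i` with `exp Y_i = τ_i` (`Y_i = V diag(i·arg d_{ik}) V⋆` with one diagonalising unitary `V`). [folklore] -/
theorem exists_commuting_skewAdjoint_log (τ : ι → Matrix n n ℂ) (hτ : ∀ i, τ i ∈ Matrix.unitaryGroup n ℂ)
    (hc : ∀ i j, Commute (τ i) (τ j)) :
    ∃ Y : ι → Matrix n n ℂ, (∀ i, Y i ∈ skewAdjoint (Matrix n n ℂ)) ∧ (∀ i j, Commute (Y i) (Y j)) ∧
      ∀ i, NormedSpace.exp (Y i) = τ i := by
  obtain ⟨V, hV, dg, hdg⟩ := exists_unitaryGroup_forall_conj_eq_diagonal_of_commute τ hτ hc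
  have hVV : star V * V = 1 := Matrix.mem_unitaryGroup_iff'.mp hV
  have hVV' : V * star V = 1 := Matrix.mem_unitaryGroup_iff.mp hV
  -- the diagonal entries lie on the circle
  have hnorm : ∀ i k, ‖dg i k‖ = 1 := by
    intro i k
    have hmem : diagonal (dg i) ∈ Matrix.unitaryGroup n ℂ := by
      rw [← hdg i]
      exact mul_mem (mul_mem (Unitary.star_mem hV) (hτ i)) hV
    exact norm_eq_one_of_diagonal_mem_unitaryGroup hmem k
  refine ⟨fun i => V * diagonal (fun k => (Complex.arg (dg i k) : ℂ) * Complex.I) * star V,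
    fun i => conj_mem_skewAdjoint (diagonal_mul_I_mem_skewAdjoint _), fun i j => ?_, fun i => ?_⟩
  · -- conjugates of diagonal matrices commute
    show V * diagonal _ * star V * (V * diagonal _ * star V) = V * diagonal _ * star V * (V * diagonal _ * star V)
    have hdd : diagonal (fun k => (Complex.arg (dg i k) : ℂ) * Complex.I) * diagonal (fun k => (Complex.arg (dg j k) : ℂ) * Complex.I)
        = diagonal (fun k => (Complex.arg (dg j k) : ℂ) * Complex.I) * diagonal (fun k => (Complex.arg (dg i k) : ℂ) * Complex.I) := by
      rw [diagonal_mul_diagonal, diagonal_mul_diagonal]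
      congr 1; funext k; ring
    calc V * diagonal _ * star V * (V * diagonal _ * star V)
        = V * (diagonal (fun k => (Complex.arg (dg i k) : ℂ) * Complex.I) * (star V * V)
            * diagonal (fun k => (Complex.arg (dg j k) : ℂ) * Complex.I)) * star V := by simp only [Matrix.mul_assoc]
      _ = V * (diagonal (fun k => (Complex.arg (dg j k) : ℂ) * Complex.I) * (star V * V)
            * diagonal (fun k => (Complex.arg (dg i k) : ℂ) * Complex.I)) * star V := by rw [hVV, Matrix.mul_one, Matrix.mul_one, hdd]
      _ = V * diagonal _ * star V * (V * diagonal _ * star V) := by simp only [Matrix.mul_assoc]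
  · -- `exp (V diag(i arg d) V⋆) = V diag(e^{i arg d}) V⋆ = V diag(d) V⋆ = τ`
    rw [exp_unitary_conj hV, exp_diagonal_mul_I]
    have hd : (diagonal fun k => Complex.exp ((Complex.arg (dg i k) : ℂ) * Complex.I)) = diagonal (dg i) := by
      congr 1; funext k; exact exp_arg_mul_I (hnorm i k)
    rw [hd, ← hdg i]
    calc V * (star V * τ i * V) * star V = (V * star V) * τ i * (V * star V) := by simp only [Matrix.mul_assoc]
      _ = τ i := by rw [hVV', Matrix.one_mul, Matrix.mul_one]

end

end Summit.QuantumFields.BalabanUV.T4Continuum.NE7CommutingUnitaryLogs
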